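import Summits.BirchSwinnertonDyer.Rank1Residual.AdditivePotMult.RankOneIndexCertificateOdd
import Literature.NumberTheory.EllipticCurves.MatarNekovar2019.ShaVanishing
import HarnessLib

/-!
# Rank ONE at an additive (indeed ANY bad) ODD prime: the exact Heegner-index certificate closes the
# pair and its rank-zero Heegner twist under IRREDUCIBILITY of `E[p]` ONLY — the image binder `Surj`
# leaves the rank-one X4(M) lever (cell `b2b-bsdres`, sub-cell additive-p1, gen 13)

HONEST FRAMING (cell `b2b-bsdres`, run/shared/lean/b2b/bsd-rank1-residual/, verbatim in every
file): the goal of the cell is to DELETE the COMBINATION-SHAPED residual classes of the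
Birch–Swinnerton-Dyer formula for ALL analytic-rank `≤ 1` elliptic curves over `ℚ` — "full BSD
formula for every rank `≤ 1` curve in class `C`" assembled STRICTLY from published theorems — so
that the rank-`≤ 1` remainder becomes exactly the CONSTRUCTION-SHAPED classes, which are TYPED
(missing-input `Prop`s), NOT attempted. This is not "finishing BSD". Sub-cell additive-p1 is a
RESEARCH ROUTE on the construction-shaped classes X3♯(M) / X4(M) (additive, potentially
multiplicative `p`); no claim beyond the stated sub-classes; X3/X4 labels are UNCHANGED by this file;
NOTHING is booked here (a per-pair closure is the referee's ruling on the lane's certificates).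

THEOREMS ONLY (no definition, no named fact). PER PAIR, not a class theorem. WHAT THIS FILE RECORDS:
Gen 10's `RankOneIndexCertificateOdd.lean` (p238704) reads the EXACT Heegner-index certificate
`p ∤ [E(K):ℤy_K]` ∧ `ord_p (L(E^{d_K},1)/Ω) = 0` ∧ `p ∤ ∏_ℓ c_ℓ(E)` ∧ `p ∤ c(D)` at a rank-one pair into
`BSD(E,p) ∧ BSD(E^{d_K},p)` through Kolyvagin's bound in McCallum's form (`p` odd, `ρ̄_{E,p}` ONTO), so
every reading on X4(M) carried the binder `Surj W p`. The image hypothesis is NOT needed: A. Matar,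
J. Nekovář, J. Théor. Nombres Bordeaux **31** (2019), Thm. 6.7 (1) (p. 498; unchanged by the
Correction, JTNB 33 (2021)) — the tree's PUBLISHED named fact
`MatarNekovar2019.thm67_sha_primary_trivial_of_irreducible` (`ShaVanishing.lean`, cell row A58) —
gives `Ш(E/K)[p^∞] = 0` from `y_K ∉ pE(K)` for EVERY odd `p` at which `E[p]` is an IRREDUCIBLE
`𝔽_p[G_ℚ]`-module, `(K,p) ≠ (ℚ(√−3),3)` (automatic: `p ∣ N_E` splits in `K`), no `p ∤ D_K`, no
condition on the reduction at `p`. `Irr W p` is PART of `ClassX4 W p`, so the rank-one exact-index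
lever on X4(M) becomes IMAGE-FREE (`ClassX4M.bsdp_rankOne_of_indexCertificate`). What moves (REPORT
§18): the rank-one X4(M) pairs with irreducible NON-surjective `ρ̄_{E,p}` (`p = 3`, images `3Ns`/`3Nn`:
window 2178h1, 11520p1, lane residue list E = 54 classes; `p ∈ {5,7}`: `p ∣ ord_p j`; 56 S-b pairs)
had NO class-level kernel statement (RESIDUAL-MAP §E, E-iii ∧ ¬Surj); they now have the lever of the
surjective pairs. X3♯(M) in rank one (`E[p]` REDUCIBLE) is NOT reached: Matar–Nekovář §0.10 (p. 457)
"the current state of the art requires an irreducibility assumption for `ρ̄_{E,p}` … in order to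
obtain, by Kolyvagin's method, an upper bound on the size of `Ш(E/K)[p^∞]` without any error terms".
Contents: §0 folklore (`Ш[p^∞] = 0` ⇒ `ord_p # = 0`; the index bridge, re-proved because the
sibling's copy is `private`); §1 data level `bsdp_of_rankOne_of_indexCertificate_of_irr`; §2
conductor level `…_of_dvd_of_irr` (pair), `bsdp_and_bsdp_twist_of_indexCertificate_of_odd_of_irr`
(pair AND twist); §3 `ClassX4M.bsdp_rankOne_of_indexCertificate` (NO image hypothesis),
`ClassX4.bsdp_rankOne_of_indexCertificate_of_odd` (any additive type; class-agnostic offer).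

References: [MatarNekovar2019] Thm. 6.7 (1), §6.1, Prop. 6.4–6.5, 5.26, §0.10; [MatarNekovar2021Correction];
[JetchevSkinnerWan2017] §7.4; [GrossZagier1986]; [Miller2011LMS] Def. 1.1; [SilvermanATAEC1994] IV.9.4.
-/

noncomputable section

open scoped Classical NumberField
open WeierstrassCurve NumberField Literature.NumberTheory.EllipticCurves
  Literature.NumberTheory.EllipticCurves.ModularForms
  Literature.NumberTheory.EllipticCurves.Rank1Residual
  Literature.NumberTheory.EllipticCurves.Rank1Residual.Typed
  Literature.NumberTheory.EllipticCurves.KrizLi2019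
  Literature.NumberTheory.QuadraticFields
  Literature.NumberTheory.Automorphic
  IsDedekindDomain

namespace Summit.BirchSwinnertonDyer.Rank1Residual.AdditivePotMult

/-! ### §0 Folklore: `Ш[p^∞] = 0` in a finite group, and the index bridge -/

/-- **`p`-primary triviality ⇒ order prime to `p`** in a finite abelian group (Cauchy: `p ∣ #G` gives
an element of order `p`) — the numerical shadow of Matar–Nekovář's `Ш(E/K)[p^∞] = 0`.
[cite: MatarNekovar2019, Thm. 6.7 (1) (p. 498)] -/
theorem padicValNat_card_eq_zero_of_forall_pow_smul {G : Type*} [AddCommGroup G] [Finite G]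
    {p : ℕ} (hp : p.Prime) (h : ∀ (x : G) (n : ℕ), p ^ n • x = 0 → x = 0) :
    padicValNat p (Nat.card G) = 0 := by
  haveI : Fact p.Prime := ⟨hp⟩
  refine padicValNat.eq_zero_of_not_dvd fun hdvd => ?_
  obtain ⟨x, hx⟩ := exists_prime_addOrderOf_dvd_card' (G := G) p hdvd
  have hpx : p ^ 1 • x = 0 := by
    rw [pow_one, ← hx]
    exact addOrderOf_nsmul_eq_zero x
  have hx0 : x ≠ 0 := by
    rintro rfl
    rw [addOrderOf_zero] at hx
    exact hp.one_lt.ne hx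
  exact hx0 (h x 1 hpx)

/-- In any abelian group: for `Q` of infinite order, `p` divides the index of `ℤ·(p•Q)`
(`[G : ℤ(pQ)] = [G : ℤQ]·p`, an infinite index being `0`). Re-proof of the `private` lemma of
`MatarNekovar2019/ShaVanishing.lean`. [cite: MatarNekovar2019, (6.3.1) (p. 497)] -/
private theorem dvd_index_zmultiples_nsmul' {G : Type*} [AddCommGroup G] (Q : G)
    (hQ : ¬ IsOfFinAddOrder Q) (p : ℕ) : p ∣ (AddSubgroup.zmultiples (p • Q)).index := by
  set H := AddSubgroup.zmultiples (p • Q) with hH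
  have hHK : H ≤ AddSubgroup.zmultiples Q :=
    AddSubgroup.zmultiples_le_of_mem
      ((AddSubgroup.zmultiples Q).nsmul_mem (AddSubgroup.mem_zmultiples Q) p)
  have h1 : H.relIndex (AddSubgroup.zmultiples Q) ∣ H.index :=
    ⟨_, (AddSubgroup.relIndex_mul_index hHK).symm⟩
  refine dvd_trans ?_ h1
  have h2 : H.relIndex (AddSubgroup.zmultiples Q) = (H.comap (zmultiplesHom G Q)).index := by
    rw [← AddSubgroup.range_zmultiplesHom, AddMonoidHom.range_eq_map, ← AddSubgroup.relIndex_comap,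
      AddSubgroup.relIndex_top_right]
  rw [h2]
  have hinj : Function.Injective fun n : ℤ => n • Q := injective_zsmul_iff_not_isOfFinAddOrder.mpr hQ
  have h3 : H.comap (zmultiplesHom G Q) ≤ AddSubgroup.zmultiples (p : ℤ) := by
    intro n hn
    rw [AddSubgroup.mem_comap, hH, AddSubgroup.mem_zmultiples_iff] at hn
    obtain ⟨m, hm⟩ := hn
    have hm' : (m * p : ℤ) • Q = n • Q := by
      rw [← smul_smul, natCast_zsmul]
      simpa using hm
    have hmn : m * p = n := hinj hm'
    exact AddSubgroup.mem_zmultiples_iff.mpr ⟨m, by rw [← hmn, smul_eq_mul]⟩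
  refine dvd_trans ?_ (AddSubgroup.index_dvd_of_le h3)
  rw [AddSubgroup.index, Nat.card_congr (Int.quotientZMultiplesNatEquivZMod p).toEquiv, Nat.card_zmod]

/-- **The index bridge**: for a point `P` of infinite order, `p ∤ [G : ℤP]` implies `P ∉ pG` — the
lane's certificate `ord_p [E(K):ℤy_K] = 0` in Matar–Nekovář's printed form `y_K ∉ pE(K)`.
[cite: MatarNekovar2019, Thm. 6.7 (1) (p. 498) and (6.3.1) (p. 497)] -/
theorem not_exists_smul_eq_of_not_dvd_index' {G : Type*} [AddCommGroup G] {P : G}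
    (hP : ¬ IsOfFinAddOrder P) {p : ℕ} (hI : ¬ p ∣ (AddSubgroup.zmultiples P).index) :
    ¬ ∃ Q : G, p • Q = P := by
  rintro ⟨Q, rfl⟩
  have hQ : ¬ IsOfFinAddOrder Q := fun h => hP (h.nsmul (n := p))
  exact hI (dvd_index_zmultiples_nsmul' Q hQ p)

/-! ### §1 Data level: the exact certificate gives `BSD(E,p)` under irreducibility only -/

/-- **`BSD(E,p)` in rank one from the exact index certificate, ANY odd `p` with `E[p]` IRREDUCIBLE —
no surjectivity —, any reduction type at `p` (additive included).** Data: `W/ℚ` globally minimal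
with `ord_{s=1} L(E,s) = 1`; `K` imaginary quadratic with the Heegner hypothesis for the level `N`,
`(K,p) ≠ (ℚ(√−3),3)`; `P ∈ E(K)` the Heegner point of a parametrisation datum `Dt` with `p ∤ c(Dt)`;
`p` odd with `p ∤ #𝓞_K^×`; `Wd = Cd • W^{(d_K)}` globally minimal with `ord_p u(Cd) = 0`. CERTIFICATE:
`q_d = L(E^{d_K},1)/Ω(Wd) ≠ 0` with `ord_p q_d = 0`, `p ∤ [E(K):ℤP]`, `p ∤ ∏_ℓ c_ℓ(E)`. CONCLUSION:
`BSDp W p`: gen 5's `padicValRat_shaAn_eq_zero_of_indexCertificate` (Gross–Zagier bookkeeping,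
`X11b.exists_shaAn_padicVal_eq_of_heegner`) gives `ord_p #Ш(E)_an = 0`; `y_K` is non-torsion
(`L'(E/K,1) ≠ 0`); Matar–Nekovář Thm. 6.7 (1) (`hMN`) gives `Ш(E/K)[p^∞] = 0`, whence `Ш(E/ℚ)[p] = 0`
(`Typed.bsdp_of_matarNekovar_of_not_dvd_index`). Gen 5's theorem with `Surj` replaced by `Irr`.
[cite: MatarNekovar2019, Thm. 6.7 (1) (p. 498)] [cite: JetchevSkinnerWan2017, §7.4.1 (eq:gz for K′)]
[cite: Miller2011LMS, Def. 1.1] -/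
theorem bsdp_of_rankOne_of_indexCertificate_of_irr
    (W : WeierstrassCurve ℚ) [W.IsElliptic] [W.IsGloballyMinimal] (p : ℕ) [Fact p.Prime]
    (N : ℕ) [NeZero N] (K : Type) [Field K] [NumberField K]
    (Dt : ModularParametrizationData W N) (H : HeegnerDatum N (NumberField.discr K)) (ι : K →+* ℂ)
    (P : (W.baseChange K).toAffine.Point)
    -- the published inputs (named facts of the tree)
    (hGZ : gross_zagier N W K) (hKo : kolyvagin N W K)
    (hMN : MatarNekovar2019.thm67_sha_primary_trivial_of_irreducible N W K)
    (hGZK : rank_eq_analyticRank_of_analyticRank_le_one) (hmod : hasEntireLFunction_rat)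
    -- the pair and the Heegner data
    (hK : IsImaginaryQuadratic K) (hHN : SatisfiesHeegnerHypothesis N K)
    (h3 : p = 3 → NumberField.discr K ≠ -3)
    (hP : WeierstrassCurve.Affine.Point.map ι.toRatAlgHom P = heegnerPointComplex Dt H)
    (hp2 : p ≠ 2) (hc : ¬ (p : ℤ) ∣ Dt.c) (hμ : ¬ p ∣ Units.torsionOrder K)
    (hr : W.analyticRank = 1) (hirr : Irr W p)
    (Wd : WeierstrassCurve ℚ) [Wd.IsElliptic] [Wd.IsGloballyMinimal] (Cd : VariableChange ℚ)
    (hWd : Cd • W.quadraticTwist (NumberField.discr K : ℚ) = Wd)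
    (hu : padicValRat p (Cd.u : ℚ) = 0)
    -- the certificate
    (qd : ℚ) (hqd : Wd.entireLFunction 1 / (Wd.realPeriodRat : ℂ) = (qd : ℂ)) (hqd0 : qd ≠ 0)
    (hvd : padicValRat p qd = 0) (hI : ¬ p ∣ (AddSubgroup.zmultiples P).index)
    (htam : ¬ p ∣ W.tamagawaProduct) :
    BSDp W p := by
  obtain ⟨q, hq, hv⟩ :=
    padicValRat_shaAn_eq_zero_of_indexCertificate W p N K Dt H ι P hGZ hKo hGZK hmod hK hHN hP hp2 hc
      hμ hr hirr Wd Cd hWd hu qd hqd hqd0 hvd hI htam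
  -- the Heegner point is non-torsion: `L'(E/K,1) ≠ 0`
  have hD0 : (NumberField.discr K : ℚ) ≠ 0 := by exact_mod_cast NumberField.discr_ne_zero K
  haveI hEt : (W.quadraticTwist (NumberField.discr K : ℚ)).IsElliptic :=
    W.isElliptic_quadraticTwist hD0
  have hLt' : (W.quadraticTwist (NumberField.discr K : ℚ)).entireLFunction = Wd.entireLFunction := by
    rw [← hWd, entireLFunction_smul]
  have hLt : (W.quadraticTwist (NumberField.discr K : ℚ)).entireLFunction 1 ≠ 0 := by
    rw [hLt']
    intro h0
    apply hqd0
    have : ((qd : ℂ)) = 0 := by rw [← hqd, h0, zero_div]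
    exact_mod_cast this
  have hPH : IsHeegnerPoint N W K P := ⟨Dt, H, ι, hP⟩
  have hL0 : W.entireLFunction 1 = 0 := entireLFunction_one_eq_zero_of_analyticRank_eq_one hr
  obtain ⟨-, hderiv⟩ := leadingLCoeff_eq_deriv_of_analyticRank_eq_one hr
  have hLK : LDerivEK W K ≠ 0 := by
    rw [lDerivEK_eq_deriv_mul W K hmod hL0]
    exact mul_ne_zero hderiv hLt
  have hnt : ¬ IsOfFinAddOrder P :=
    (lDerivEK_ne_zero_iff_not_isOfFinAddOrder W N K hGZ hK hHN hPH).mp hLK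
  exact bsdp_of_matarNekovar_of_not_dvd_index W p hGZK hMN hK hHN hPH hnt hp2 hirr h3 hI
    (le_of_eq hr) hq hv

/-! ### §2 Conductor level, any odd `p ∣ N_E` -/

/-- **Rank one, ANY odd `p ∣ N_E` (additive included), `E[p]` IRREDUCIBLE: `BSD(E,p)` from the exact
index certificate** at any Heegner field with `d_K < −4` — the image-free form of gen 10's
`bsdp_of_rankOne_of_indexCertificate_of_dvd` (`ord_p u(Cd) = 0` for the minimal twist model since
`p ∣ N_E` splits in `K`; `p ∤ w_K = 2`; `p ∤ d_K`, so `(K,p) ≠ (ℚ(√−3),3)`). CERTIFICATE: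
`q_d = L(E^{d_K},1)/Ω(Wd) ≠ 0` with `ord_p q_d = 0`, `p ∤ [E(K):ℤP]`, `p ∤ ∏_ℓ c_ℓ(E)`, `p ∤ c(Dt)`.
No parity condition on `d_K`. Per pair; nothing booked.
[cite: MatarNekovar2019, Thm. 6.7 (1) (p. 498)] [cite: JetchevSkinnerWan2017, §7.4.1 (eq:gz for K′)]
[cite: Miller2011LMS, Def. 1.1] -/
theorem bsdp_of_rankOne_of_indexCertificate_of_dvd_of_irr
    (W : WeierstrassCurve ℚ) [W.IsElliptic] [W.IsGloballyMinimal] (p : ℕ) [Fact p.Prime]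
    [NeZero (W.conductorNorm ℤ)] (K : Type) [Field K] [NumberField K]
    (Dt : ModularParametrizationData W (W.conductorNorm ℤ))
    (H : HeegnerDatum (W.conductorNorm ℤ) (NumberField.discr K)) (ι : K →+* ℂ)
    (P : (W.baseChange K).toAffine.Point)
    -- the published inputs (named facts of the tree)
    (hGZ : gross_zagier (W.conductorNorm ℤ) W K) (hKo : kolyvagin (W.conductorNorm ℤ) W K)
    (hMN : MatarNekovar2019.thm67_sha_primary_trivial_of_irreducible (W.conductorNorm ℤ) W K)
    (hGZK : rank_eq_analyticRank_of_analyticRank_le_one) (hmod : hasEntireLFunction_rat)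
    -- the pair and the Heegner data
    (hp2 : p ≠ 2) (hpN : p ∣ W.conductorNorm ℤ) (hr : W.analyticRank = 1) (hirr : Irr W p)
    (hK : IsImaginaryQuadratic K) (hHN : SatisfiesHeegnerHypothesis (W.conductorNorm ℤ) K)
    (hdK : NumberField.discr K < -4)
    (hP : WeierstrassCurve.Affine.Point.map ι.toRatAlgHom P = heegnerPointComplex Dt H)
    (hc : ¬ (p : ℤ) ∣ Dt.c)
    (Wd : WeierstrassCurve ℚ) [Wd.IsElliptic] [Wd.IsGloballyMinimal] (Cd : VariableChange ℚ)
    (hWd : Cd • W.quadraticTwist (NumberField.discr K : ℚ) = Wd)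
    -- the certificate
    (qd : ℚ) (hqd : Wd.entireLFunction 1 / (Wd.realPeriodRat : ℂ) = (qd : ℂ)) (hqd0 : qd ≠ 0)
    (hvd : padicValRat p qd = 0) (hI : ¬ p ∣ (AddSubgroup.zmultiples P).index)
    (htam : ¬ p ∣ W.tamagawaProduct) :
    BSDp W p := by
  have hp : p.Prime := Fact.out
  -- `w_K = 2`, prime to the odd `p`; `ord_p u = 0`; `p ∤ d_K`
  have hμ : ¬ p ∣ Units.torsionOrder K := by
    rw [Literature.NumberTheory.DiophantineGeometry.torsionOrder_eq_two_of_discr_lt hK.1 hdK]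
    intro h2
    exact hp2 ((Nat.prime_dvd_prime_iff_eq hp Nat.prime_two).mp h2)
  have hu : padicValRat p (Cd.u : ℚ) = 0 :=
    padicValRat_u_eq_zero_of_twist_minimal_of_dvd W p K hK hHN hpN Cd hWd
  have hpd : ¬ (p : ℤ) ∣ NumberField.discr K :=
    Literature.SatisfiesHeegnerHypothesis.not_dvd_discr hK.1 hHN hp hpN
  have h3 : p = 3 → NumberField.discr K ≠ -3 := by
    rintro rfl h
    exact hpd ⟨-1, by rw [h]; norm_num⟩
  exact bsdp_of_rankOne_of_indexCertificate_of_irr W p (W.conductorNorm ℤ) K Dt H ι P hGZ hKo hMN hGZK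
    hmod hK hHN h3 hP hp2 hc hμ hr hirr Wd Cd hWd hu qd hqd hqd0 hvd hI htam

/-- **Rank one, ANY odd `p ∣ N_E`, `E[p]` IRREDUCIBLE, Heegner field with `d_K` ODD and `d_K < −4`:
the exact index certificate closes BOTH the pair and its rank-zero Heegner twist at `p`** — the
image-free form of gen 10's `bsdp_and_bsdp_twist_of_indexCertificate_of_odd`. The twist:
Matar–Nekovář Thm. 6.7 (1) gives `Ш(E/K)[p^∞] = 0`, so `ord_p #Ш(E/K) = 0` (`Ш(E/K)` finite); the
identity `X11b.exists_shaAn_padicVal_eq_of_heegner` gives `ord_p #Ш(E/K) = ord_p #Ш(E) + ord_p #Ш(Wd)`,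
so `ord_p #Ш(Wd) = 0`; `p ∤ ∏c_ℓ(Wd)` by eisenstein-p2's odd-`d_K` Tamagawa transport; no rational
`p`-torsion; rank-zero print shape. CONCLUSION: `BSDp W p ∧ BSDp Wd p`. Per pair; nothing booked;
class-agnostic (X4 any additive type, X7, X8, X9/X10, X11 rank-one pairs with `E[p]` irreducible).
[cite: MatarNekovar2019, Thm. 6.7 (1) (p. 498)] [cite: JetchevSkinnerWan2017, §7.4 (pp. 29–31)]
[cite: SilvermanATAEC1994, IV.9.4 Table 4.1] [cite: Miller2011LMS, Def. 1.1] -/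
theorem bsdp_and_bsdp_twist_of_indexCertificate_of_odd_of_irr
    (W : WeierstrassCurve ℚ) [W.IsElliptic] [W.IsGloballyMinimal] (p : ℕ) [Fact p.Prime]
    [NeZero (W.conductorNorm ℤ)] (K : Type) [Field K] [NumberField K]
    (Dt : ModularParametrizationData W (W.conductorNorm ℤ))
    (H : HeegnerDatum (W.conductorNorm ℤ) (NumberField.discr K)) (ι : K →+* ℂ)
    (P : (W.baseChange K).toAffine.Point)
    -- the published inputs (named facts of the tree)
    (hGZ : gross_zagier (W.conductorNorm ℤ) W K) (hKo : kolyvagin (W.conductorNorm ℤ) W K)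
    (hMN : MatarNekovar2019.thm67_sha_primary_trivial_of_irreducible (W.conductorNorm ℤ) W K)
    (hGZK : rank_eq_analyticRank_of_analyticRank_le_one) (hmod : hasEntireLFunction_rat)
    -- the pair and the Heegner data
    (hp2 : p ≠ 2) (hpN : p ∣ W.conductorNorm ℤ) (hr : W.analyticRank = 1) (hirr : Irr W p)
    (hK : IsImaginaryQuadratic K) (hHN : SatisfiesHeegnerHypothesis (W.conductorNorm ℤ) K)
    (hodd : Odd (NumberField.discr K)) (hdK : NumberField.discr K < -4)
    (hP : WeierstrassCurve.Affine.Point.map ι.toRatAlgHom P = heegnerPointComplex Dt H)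
    (hc : ¬ (p : ℤ) ∣ Dt.c)
    (Wd : WeierstrassCurve ℚ) [Wd.IsElliptic] [Wd.IsGloballyMinimal] (Cd : VariableChange ℚ)
    (hWd : Cd • W.quadraticTwist (NumberField.discr K : ℚ) = Wd)
    -- the certificate
    (qd : ℚ) (hqd : Wd.entireLFunction 1 / (Wd.realPeriodRat : ℂ) = (qd : ℂ)) (hqd0 : qd ≠ 0)
    (hvd : padicValRat p qd = 0) (hI : ¬ p ∣ (AddSubgroup.zmultiples P).index)
    (htam : ¬ p ∣ W.tamagawaProduct) :
    BSDp W p ∧ BSDp Wd p := by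
  have hp : p.Prime := Fact.out
  -- `w_K = 2`, prime to the odd `p`; `ord_p u = 0`; `p ∤ d_K`, so `(K,p) ≠ (ℚ(√-3),3)`
  have hμ : ¬ p ∣ Units.torsionOrder K := by
    rw [Literature.NumberTheory.DiophantineGeometry.torsionOrder_eq_two_of_discr_lt hK.1 hdK]
    intro h2
    exact hp2 ((Nat.prime_dvd_prime_iff_eq hp Nat.prime_two).mp h2)
  have hu : padicValRat p (Cd.u : ℚ) = 0 :=
    padicValRat_u_eq_zero_of_twist_minimal_of_dvd W p K hK hHN hpN Cd hWd
  have hpd : ¬ (p : ℤ) ∣ NumberField.discr K :=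
    Literature.SatisfiesHeegnerHypothesis.not_dvd_discr hK.1 hHN hp hpN
  have h3 : p = 3 → NumberField.discr K ≠ -3 := by
    rintro rfl h
    exact hpd ⟨-1, by rw [h]; norm_num⟩
  refine ⟨bsdp_of_rankOne_of_indexCertificate_of_irr W p (W.conductorNorm ℤ) K Dt H ι P hGZ hKo hMN
    hGZK hmod hK hHN h3 hP hp2 hc hμ hr hirr Wd Cd hWd hu qd hqd hqd0 hvd hI htam, ?_⟩
  ---------------------------------------------------------------- the twist
  have hD0 : (NumberField.discr K : ℚ) ≠ 0 := by exact_mod_cast NumberField.discr_ne_zero K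
  haveI hEt : (W.quadraticTwist (NumberField.discr K : ℚ)).IsElliptic :=
    W.isElliptic_quadraticTwist hD0
  have hLt' : (W.quadraticTwist (NumberField.discr K : ℚ)).entireLFunction = Wd.entireLFunction := by
    rw [← hWd, entireLFunction_smul]
  have hLt : (W.quadraticTwist (NumberField.discr K : ℚ)).entireLFunction 1 ≠ 0 := by
    rw [hLt']
    intro h0
    apply hqd0
    have : ((qd : ℂ)) = 0 := by rw [← hqd, h0, zero_div]
    exact_mod_cast this
  have hLd1 : Wd.entireLFunction 1 ≠ 0 := by rw [← hLt']; exact hLt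
  have hrd : Wd.analyticRank = 0 := (Wd.analyticRank_eq_zero_iff_holds (hmod Wd)).2 hLd1
  have hirrd : Wd.HasIrreducibleModPGaloisRep p :=
    X11b.hasIrreducibleModPGaloisRep_twist_model W p K hK.1 hirr Cd hWd
  have htors : padicValNat p Wd.torsionOrder = 0 :=
    padicValNat_torsionOrder_eq_zero_of_irreducible Wd p hirrd
  have htamd : padicValNat p Wd.tamagawaProduct = 0 := by
    rw [X2.padicValNat_tamagawaProduct_twist_of_heegner_of_odd W p hp2 K hK hodd hpd hHN Cd hWd]
    exact padicValNat.eq_zero_of_not_dvd htam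
  -- the identity: finiteness and the `Ш` decomposition over `K`
  obtain ⟨hfinW, hfinK, hsum, -⟩ :=
    X11b.exists_shaAn_padicVal_eq_of_heegner W p (W.conductorNorm ℤ) K Dt H ι P hGZ hKo hGZK hmod hK
      hHN hP hp2 hc hμ hr hLt Wd Cd hWd hu qd hqd
  -- the Heegner point is non-torsion; Matar–Nekovář kills `Ш(E/K)[p^∞]`
  have hPH : IsHeegnerPoint (W.conductorNorm ℤ) W K P := ⟨Dt, H, ι, hP⟩
  have hL0 : W.entireLFunction 1 = 0 := entireLFunction_one_eq_zero_of_analyticRank_eq_one hr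
  obtain ⟨-, hderiv⟩ := leadingLCoeff_eq_deriv_of_analyticRank_eq_one hr
  have hLK : LDerivEK W K ≠ 0 := by
    rw [lDerivEK_eq_deriv_mul W K hmod hL0]
    exact mul_ne_zero hderiv hLt
  have hnt : ¬ IsOfFinAddOrder P :=
    (lDerivEK_ne_zero_iff_not_isOfFinAddOrder W (W.conductorNorm ℤ) K hGZ hK hHN hPH).mp hLK
  have hdiv : ¬ ∃ Q : (W.baseChange K).toAffine.Point, p • Q = P :=
    not_exists_smul_eq_of_not_dvd_index' hnt hI
  have hK0 := hMN hK hHN hPH hp hp2 hirr h3 hdiv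
  haveI : Finite (W.baseChange K).sha := hfinK
  have hK1 : padicValNat p (Nat.card (W.baseChange K).sha) = 0 :=
    padicValNat_card_eq_zero_of_forall_pow_smul (G := (W.baseChange K).sha) hp hK0
  have hKsha : padicValNat p (W.baseChange K).shaOrder = 0 := by
    simpa [WeierstrassCurve.shaOrder] using hK1
  have hshad : padicValNat p Wd.shaOrder = 0 := by
    rw [hKsha] at hsum
    omega
  -- the rank-zero print shape for the twist
  refine bsdp_of_pPartRankZero Wd p hmod hGZK hrd ⟨qd, hqd, ?_⟩
  rw [hvd, hshad, htamd, htors]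
  simp

/-! ### §3 This sub-cell: X4(M) (and X4) rank-one pairs at every odd `p`, NO image hypothesis -/

variable {W : WeierstrassCurve ℚ} [W.IsElliptic] {p : ℕ} [Fact p.Prime]

/-- **X4(M), rank one, ANY odd `p` — NO image hypothesis: `BSD(E,p)` and `BSD(E^{d_K},p)` from the
exact index certificate at a Heegner field with odd `d_K < −4`.** `Irr W p` is part of `ClassX4 W p`,
and that is all Matar–Nekovář Thm. 6.7 (1) asks of the image; `p ∣ N_E` because `p` is additive.
Supersedes gen 10's `…_of_surj` / `…_of_not_dvd_padicValRat_j` as to the image. NEW per-pair reach: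
the rank-one X4(M) pairs with irreducible NON-surjective `ρ̄_{E,p}` (`p = 3`: `3Ns`/`3Nn`, window
2178h1, 11520p1, lane residue list E; `p ∈ {5,7}`: `p ∣ ord_p j`). Per pair; label unchanged.
[cite: MatarNekovar2019, Thm. 6.7 (1) (p. 498)] [cite: Miller2011LMS, Def. 1.1] -/
theorem ClassX4M.bsdp_rankOne_of_indexCertificate [W.IsGloballyMinimal]
    [NeZero (W.conductorNorm ℤ)]
    (hX : ClassX4M W p) (hr : W.analyticRank = 1)
    (K : Type) [Field K] [NumberField K]
    (Dt : ModularParametrizationData W (W.conductorNorm ℤ))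
    (H : HeegnerDatum (W.conductorNorm ℤ) (NumberField.discr K)) (ι : K →+* ℂ)
    (P : (W.baseChange K).toAffine.Point)
    (hGZ : gross_zagier (W.conductorNorm ℤ) W K) (hKo : kolyvagin (W.conductorNorm ℤ) W K)
    (hMN : MatarNekovar2019.thm67_sha_primary_trivial_of_irreducible (W.conductorNorm ℤ) W K)
    (hGZK : rank_eq_analyticRank_of_analyticRank_le_one) (hmod : hasEntireLFunction_rat)
    (hK : IsImaginaryQuadratic K) (hHN : SatisfiesHeegnerHypothesis (W.conductorNorm ℤ) K)
    (hodd : Odd (NumberField.discr K)) (hdK : NumberField.discr K < -4)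
    (hP : WeierstrassCurve.Affine.Point.map ι.toRatAlgHom P = heegnerPointComplex Dt H)
    (hc : ¬ (p : ℤ) ∣ Dt.c)
    (Wd : WeierstrassCurve ℚ) [Wd.IsElliptic] [Wd.IsGloballyMinimal] (Cd : VariableChange ℚ)
    (hWd : Cd • W.quadraticTwist (NumberField.discr K : ℚ) = Wd)
    (qd : ℚ) (hqd : Wd.entireLFunction 1 / (Wd.realPeriodRat : ℂ) = (qd : ℂ)) (hqd0 : qd ≠ 0)
    (hvd : padicValRat p qd = 0) (hI : ¬ p ∣ (AddSubgroup.zmultiples P).index)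
    (htam : ¬ p ∣ W.tamagawaProduct) :
    BSDp W p ∧ BSDp Wd p :=
  have hpN : p ∣ W.conductorNorm ℤ :=
    (W.dvd_conductorNorm_iff_not_hasGoodReductionAtPrime p).mpr (not_good_of_addv W p hX.1.2.1)
  bsdp_and_bsdp_twist_of_indexCertificate_of_odd_of_irr W p K Dt H ι P hGZ hKo hMN hGZK hmod
    hX.p_ne_two hpN hr hX.irr hK hHN hodd hdK hP hc Wd Cd hWd qd hqd hqd0 hvd hI htam

/-- **X4 (ANY additive type), rank one, ANY odd `p` — NO image hypothesis beyond the class's own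
irreducibility: `BSD(E,p)` and `BSD(E^{d_K},p)` from the exact index certificate** at a Heegner field
with odd `d_K < −4`. Class-agnostic offer (additive-p2/p4; X7/X8/X9/X10/X11b rank-one rows with
`E[p]` irreducible): the lane's T-KOLY flag `surj` is not a hypothesis of the printed theorem.
[cite: MatarNekovar2019, Thm. 6.7 (1) (p. 498)] [cite: Miller2011LMS, Def. 1.1] -/
theorem ClassX4.bsdp_rankOne_of_indexCertificate_of_odd [W.IsGloballyMinimal]
    [NeZero (W.conductorNorm ℤ)]
    (hX : ClassX4 W p) (hr : W.analyticRank = 1)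
    (K : Type) [Field K] [NumberField K]
    (Dt : ModularParametrizationData W (W.conductorNorm ℤ))
    (H : HeegnerDatum (W.conductorNorm ℤ) (NumberField.discr K)) (ι : K →+* ℂ)
    (P : (W.baseChange K).toAffine.Point)
    (hGZ : gross_zagier (W.conductorNorm ℤ) W K) (hKo : kolyvagin (W.conductorNorm ℤ) W K)
    (hMN : MatarNekovar2019.thm67_sha_primary_trivial_of_irreducible (W.conductorNorm ℤ) W K)
    (hGZK : rank_eq_analyticRank_of_analyticRank_le_one) (hmod : hasEntireLFunction_rat)
    (hK : IsImaginaryQuadratic K) (hHN : SatisfiesHeegnerHypothesis (W.conductorNorm ℤ) K)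
    (hodd : Odd (NumberField.discr K)) (hdK : NumberField.discr K < -4)
    (hP : WeierstrassCurve.Affine.Point.map ι.toRatAlgHom P = heegnerPointComplex Dt H)
    (hc : ¬ (p : ℤ) ∣ Dt.c)
    (Wd : WeierstrassCurve ℚ) [Wd.IsElliptic] [Wd.IsGloballyMinimal] (Cd : VariableChange ℚ)
    (hWd : Cd • W.quadraticTwist (NumberField.discr K : ℚ) = Wd)
    (qd : ℚ) (hqd : Wd.entireLFunction 1 / (Wd.realPeriodRat : ℂ) = (qd : ℂ)) (hqd0 : qd ≠ 0)
    (hvd : padicValRat p qd = 0) (hI : ¬ p ∣ (AddSubgroup.zmultiples P).index)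
    (htam : ¬ p ∣ W.tamagawaProduct) :
    BSDp W p ∧ BSDp Wd p :=
  have hpN : p ∣ W.conductorNorm ℤ :=
    (W.dvd_conductorNorm_iff_not_hasGoodReductionAtPrime p).mpr (not_good_of_addv W p hX.2.1)
  bsdp_and_bsdp_twist_of_indexCertificate_of_odd_of_irr W p K Dt H ι P hGZ hKo hMN hGZK hmod
    hX.1 hpN hr hX.2.2 hK hHN hodd hdK hP hc Wd Cd hWd qd hqd hqd0 hvd hI htam

end Summit.BirchSwinnertonDyer.Rank1Residual.AdditivePotMult

end
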